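import Summits.ResolutionOfSingularities.ResolutionOfSingularities.Theorems.FrobeniusLadderFInjectiveMacaulayficationX2CubicFormSmoothCert
import Summits.ResolutionOfSingularities.ResolutionOfSingularities.Theorems.FrobeniusLadderFInjectiveMacaulayficationX2C31Specimen
import HarnessLib

/-!
# (C′) THE FIRST NON-DIAGONAL MEMBER OF THE T-SIDE CLASS ROW: `Y = {x² + y³ + u³ + t³ + s³ + y²u}`, every prime `p ∉ {2, 3, 31}` — `tStep_row_C31`
# by ONE application of ✓p682339 `X2CubicFormTStepRow.tStep_row_of_doublePoint_cubicForm`, with GENUINELY POINTWISE smoothness certificates (Jacobian cofactor identities with the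
# resultant constant `31`) for two of the four chart cubics
# (crux `FInjectiveMacaulayfication` stmt-ResolutionOfSingularities-15315, chain w45a; res-L1-w45a-plan-1 ANSWER 00:15Z (C′); seat res-L1-w45a-lead-1 g11)

[OURS · L1 W4.5a] Support file (`--supports stmt-ResolutionOfSingularities-15315 --as helper`); def-free; UNCONDITIONAL; no named fact; NOT a statement of any manuscript. An APPLICATION of the
class row (a second member after Fermat); evidence for nothing beyond itself; T″ and the F-half OPEN; nothing of the crux proved. AI-written (AI review is weaker than expert review).

`F = Y₀³ + Y₁³ + Y₂³ + Y₃³ + Y₀²Y₁`. Dehomogenisations (variables `Z₀,Z₁,Z₂`): `w₀ = 1 + Z₀ + Z₀³ + Z₁³ + Z₂³` (at `y = 1`), `w₁ = 1 + Z₀² + Z₀³ + Z₁³ + Z₂³` (at `u = 1`),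
`w₂ = w₃ = 1 + Z₀³ + Z₁³ + Z₂³ + Z₀²Z₁` (at `t = 1`, `s = 1`).
* §1 `isHomogeneous_F`, `dehomog₀…₃`, `f_eq`.
* §2 primality of `w₀, w₁, w₂` (Eisenstein in the pure-cube variable `Z₂` at an explicit rational root of the constant term: `(1,−1)`, `(−1,−1)`, `(0,−1)`).
* §3 ★ SMOOTHNESS CERTIFICATES (`X2CubicFormSmoothCert.smooth_of_jacobian_certificate`): `w₂` by Euler; `w₀` by `31 = (27 − 18Z₀)(Z₀³ + Z₀ + 1) + (6Z₀² − 9Z₀ + 4)(3Z₀² + 1)`;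
  `w₁` by `93 = (18Z₀ + 93)(Z₀³ + Z₀² + 1) − (6Z₀² + 33Z₀ + 9)(3Z₀² + 2Z₀)` — no single derivation is a unit modulo `w₀` or `w₁`: the pointwise form of the class hypothesis is used.
* §4 ★★★ `tStep_row_C31` — SCOPE ∧ LEGAL-AND-FULL point floor ∧ `TStepInstanceAt p v 𝔪̃` for every field of characteristic `p ∉ {2, 3, 31}`.
[folklore; cite: Hartshorne1977, I Thm. 5.1; StacksProject, Tag 07PF]
-/

-- single-problem summit: the doubled namespace component is forced
set_option linter.dupNamespace false

noncomputable section

open AlgebraicGeometry CategoryTheory Literature.AlgebraicGeometry.Resolution TopologicalSpace IsLocalRing MvPolynomial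

namespace Summit.ResolutionOfSingularities.ResolutionOfSingularities.Theorems.FInjectiveMacaulayfication.X2C31ClassRow

open Summit.ResolutionOfSingularities.ResolutionOfSingularities.Theorems.FInjectiveMacaulayfication
open SliceableCentre

variable (k : Type) [Field k]

/-! ## §1 The cubic form and its dehomogenisations -/

/-- `F` is homogeneous of degree `3`. [elementary] -/
theorem isHomogeneous_F : (X 0 ^ 3 + X 1 ^ 3 + X 2 ^ 3 + X 3 ^ 3 + X 0 ^ 2 * X 1 : MvPolynomial (Fin 4) k).IsHomogeneous 3 :=
  ((((isHomogeneous_X_pow (R := k) (0 : Fin 4) 3).add (isHomogeneous_X_pow (R := k) (1 : Fin 4) 3)).add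
    (isHomogeneous_X_pow (R := k) (2 : Fin 4) 3)).add (isHomogeneous_X_pow (R := k) (3 : Fin 4) 3)).add
    ((isHomogeneous_X_pow (R := k) (0 : Fin 4) 2).mul (isHomogeneous_X (R := k) (1 : Fin 4)))

/-- The four dehomogenisations. [elementary] -/
theorem dehomog (a : Fin 4) :
    MvPolynomial.aeval ((![![1, X 0, X 1, X 2], ![X 0, 1, X 1, X 2], ![X 0, X 1, 1, X 2], ![X 0, X 1, X 2, 1]] : Fin 4 → Fin 4 → MvPolynomial (Fin 3) k) a)
      (X 0 ^ 3 + X 1 ^ 3 + X 2 ^ 3 + X 3 ^ 3 + X 0 ^ 2 * X 1 : MvPolynomial (Fin 4) k) =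
      (![1 + X 0 + X 0 ^ 3 + X 1 ^ 3 + X 2 ^ 3, 1 + X 0 ^ 2 + X 0 ^ 3 + X 1 ^ 3 + X 2 ^ 3,
        1 + X 0 ^ 3 + X 1 ^ 3 + X 2 ^ 3 + X 0 ^ 2 * X 1, 1 + X 0 ^ 3 + X 1 ^ 3 + X 2 ^ 3 + X 0 ^ 2 * X 1] : Fin 4 → MvPolynomial (Fin 3) k) a := by
  fin_cases a <;> simp <;> ring

/-- `f = X₄² + rename castSucc F` is the specimen's `X₄² + X₀³ + X₁³ + X₂³ + X₃³ + X₀²X₁`. [plumbing] -/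
theorem f_eq (f : MvPolynomial (Fin 5) k) (hf : f = X 4 ^ 2 + rename (Fin.castSucc : Fin 4 → Fin 5) (X 0 ^ 3 + X 1 ^ 3 + X 2 ^ 3 + X 3 ^ 3 + X 0 ^ 2 * X 1 : MvPolynomial (Fin 4) k)) :
    f = X 4 ^ 2 + X 0 ^ 3 + X 1 ^ 3 + X 2 ^ 3 + X 3 ^ 3 + X 0 ^ 2 * X 1 := by
  rw [hf]
  simp only [map_add, map_mul, map_pow, rename_X]
  have e0 : (Fin.castSucc (0 : Fin 4) : Fin 5) = 0 := rfl
  have e1 : (Fin.castSucc (1 : Fin 4) : Fin 5) = 1 := rfl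
  have e2 : (Fin.castSucc (2 : Fin 4) : Fin 5) = 2 := rfl
  have e3 : (Fin.castSucc (3 : Fin 4) : Fin 5) = 3 := rfl
  rw [e0, e1, e2, e3]
  ring

/-! ## §2 Primality of the chart cubics (Eisenstein in `Z₂`) -/

/-- **Eisenstein in the variable `Z₂`**: `w ∈ k[Z₀,Z₁,Z₂]` with `e w = T³ + C c'` under `e : Z₂ ↦ T, Z₀ ↦ C Z₁', Z₁ ↦ C Z₀'`, and a rational point `a'` of `c'` with some `∂_l c'(a') ≠ 0`, is prime.
[folklore; cite: Hartshorne1977, II Ex. 8.20.2 (pattern)] -/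
theorem prime_of_eisenstein_Z2 (w : MvPolynomial (Fin 3) k) (c' : MvPolynomial (Fin 2) k)
    (he : ((renameEquiv k (Equiv.swap (0 : Fin 3) 2)).trans (finSuccEquiv k 2)).toRingEquiv w = Polynomial.X ^ 3 + Polynomial.C c')
    (a' : Fin 2 → k) (hc : MvPolynomial.eval a' c' = 0) (l : Fin 2) (hder : MvPolynomial.eval a' (pderiv l c') ≠ 0) : Prime w := by
  have hirr : Irreducible (((renameEquiv k (Equiv.swap (0 : Fin 3) 2)).trans (finSuccEquiv k 2)).toRingEquiv w) := by
    rw [he]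
    exact Literature.AlgebraicGeometry.Motives.SmoothHypersurface.irreducible_X_pow_add_C (d := 3) (by norm_num) _ _ hc l hder
  exact (MulEquiv.prime_iff _).mp hirr.prime

/-- The equivalence on the variables. [plumbing] -/
theorem equiv_X :
    ((renameEquiv k (Equiv.swap (0 : Fin 3) 2)).trans (finSuccEquiv k 2)).toRingEquiv (X 2) = Polynomial.X ∧
    ((renameEquiv k (Equiv.swap (0 : Fin 3) 2)).trans (finSuccEquiv k 2)).toRingEquiv (X 0) = Polynomial.C (X 1) ∧
    ((renameEquiv k (Equiv.swap (0 : Fin 3) 2)).trans (finSuccEquiv k 2)).toRingEquiv (X 1) = Polynomial.C (X 0) := by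
  refine ⟨?_, ?_, ?_⟩
  · show finSuccEquiv k 2 (rename _ (X 2)) = _
    rw [rename_X, show (Equiv.swap (0 : Fin 3) 2) 2 = 0 by decide]; exact finSuccEquiv_X_zero
  · show finSuccEquiv k 2 (rename _ (X 0)) = _
    rw [rename_X, show (Equiv.swap (0 : Fin 3) 2) 0 = (1 : Fin 2).succ by decide]; exact finSuccEquiv_X_succ
  · show finSuccEquiv k 2 (rename _ (X 1)) = _
    rw [rename_X, show (Equiv.swap (0 : Fin 3) 2) 1 = (0 : Fin 2).succ by decide]; exact finSuccEquiv_X_succ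

/-- ★ `w₀ = 1 + Z₀ + Z₀³ + Z₁³ + Z₂³` is prime (`3 ≠ 0`): root `(Z₁', Z₀') = (1, −1)` of `c' = 1 + Z₁' + Z₁'³ + Z₀'³`, `∂_{Z₀'} c' = 3`. [folklore] -/
theorem prime_w0 (h3 : (3 : k) ≠ 0) : Prime (1 + X 0 + X 0 ^ 3 + X 1 ^ 3 + X 2 ^ 3 : MvPolynomial (Fin 3) k) := by
  obtain ⟨e2, e0, e1⟩ := equiv_X k
  refine prime_of_eisenstein_Z2 k _ (1 + X 1 + X 1 ^ 3 + X 0 ^ 3) ?_ ![1, -1] ?_ 0 ?_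
  · rw [map_add, map_add, map_add, map_add, map_one, map_pow, map_pow, map_pow, e0, e1, e2]
    simp only [map_add, map_one, map_pow]
    ring
  · simp [Matrix.cons_val_zero, Matrix.cons_val_one]; norm_num
  · have : pderiv 0 (1 + X 1 + X 1 ^ 3 + X 0 ^ 3 : MvPolynomial (Fin 2) k) = 3 * X 0 ^ 2 := by
      simp only [map_add, Derivation.map_one_eq_zero, Derivation.leibniz_pow, pderiv_X_self, pderiv_X_of_ne (show (1 : Fin 2) ≠ 0 by decide),
        zero_add, smul_eq_mul, mul_one, nsmul_eq_mul]
      push_cast; ring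
    rw [this, map_mul, map_pow, eval_X, map_ofNat]
    simpa using h3

/-- ★ `w₁ = 1 + Z₀² + Z₀³ + Z₁³ + Z₂³` is prime (`3 ≠ 0`): root `(Z₁', Z₀') = (−1, −1)` of `c' = 1 + Z₁'² + Z₁'³ + Z₀'³`, `∂_{Z₀'} c' = 3`. [folklore] -/
theorem prime_w1 (h3 : (3 : k) ≠ 0) : Prime (1 + X 0 ^ 2 + X 0 ^ 3 + X 1 ^ 3 + X 2 ^ 3 : MvPolynomial (Fin 3) k) := by
  obtain ⟨e2, e0, e1⟩ := equiv_X k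
  refine prime_of_eisenstein_Z2 k _ (1 + X 1 ^ 2 + X 1 ^ 3 + X 0 ^ 3) ?_ ![-1, -1] ?_ 0 ?_
  · rw [map_add, map_add, map_add, map_add, map_one, map_pow, map_pow, map_pow, map_pow, e0, e1, e2]
    simp only [map_add, map_one, map_pow]
    ring
  · simp [Matrix.cons_val_zero, Matrix.cons_val_one]; norm_num
  · have : pderiv 0 (1 + X 1 ^ 2 + X 1 ^ 3 + X 0 ^ 3 : MvPolynomial (Fin 2) k) = 3 * X 0 ^ 2 := by
      simp only [map_add, Derivation.map_one_eq_zero, Derivation.leibniz_pow, pderiv_X_self, pderiv_X_of_ne (show (1 : Fin 2) ≠ 0 by decide),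
        zero_add, smul_eq_mul, mul_one, nsmul_eq_mul]
      push_cast; ring
    rw [this, map_mul, map_pow, eval_X, map_ofNat]
    simpa using h3

/-- ★ `w₂ = 1 + Z₀³ + Z₁³ + Z₂³ + Z₀²Z₁` is prime (ANY field): root `(Z₀', Z₁') = (0, −1)` of `c' = 1 + Z₁'³ + Z₀'³ + Z₁'²Z₀'`, `∂_{Z₀'} c' (a') = 1`. [folklore] -/
theorem prime_w2 : Prime (1 + X 0 ^ 3 + X 1 ^ 3 + X 2 ^ 3 + X 0 ^ 2 * X 1 : MvPolynomial (Fin 3) k) := by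
  obtain ⟨e2, e0, e1⟩ := equiv_X k
  refine prime_of_eisenstein_Z2 k _ (1 + X 1 ^ 3 + X 0 ^ 3 + X 1 ^ 2 * X 0) ?_ ![0, -1] ?_ 0 ?_
  · rw [map_add, map_add, map_add, map_add, map_one, map_pow, map_pow, map_pow, map_mul, map_pow, e0, e1, e2]
    simp only [map_add, map_one, map_pow, map_mul]
    ring
  · simp [Matrix.cons_val_zero, Matrix.cons_val_one]; norm_num
  · have : pderiv 0 (1 + X 1 ^ 3 + X 0 ^ 3 + X 1 ^ 2 * X 0 : MvPolynomial (Fin 2) k) = 3 * X 0 ^ 2 + X 1 ^ 2 := by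
      simp only [map_add, Derivation.map_one_eq_zero, Derivation.leibniz_pow, Derivation.leibniz, pderiv_X_self,
        pderiv_X_of_ne (show (1 : Fin 2) ≠ 0 by decide), zero_add, smul_eq_mul, mul_one, nsmul_eq_mul]
      push_cast; ring
    rw [this]
    simp [Matrix.cons_val_zero, Matrix.cons_val_one]

/-! ## §3 Smoothness certificates -/

/-- The partials of `w₀`. [elementary] -/
theorem pderiv_w0 :
    pderiv 0 (1 + X 0 + X 0 ^ 3 + X 1 ^ 3 + X 2 ^ 3 : MvPolynomial (Fin 3) k) = 1 + 3 * X 0 ^ 2 ∧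
    pderiv 1 (1 + X 0 + X 0 ^ 3 + X 1 ^ 3 + X 2 ^ 3 : MvPolynomial (Fin 3) k) = 3 * X 1 ^ 2 ∧
    pderiv 2 (1 + X 0 + X 0 ^ 3 + X 1 ^ 3 + X 2 ^ 3 : MvPolynomial (Fin 3) k) = 3 * X 2 ^ 2 := by
  refine ⟨?_, ?_, ?_⟩ <;>
  · simp only [map_add, Derivation.map_one_eq_zero, Derivation.leibniz_pow, pderiv_X_self, pderiv_X_of_ne (show (0 : Fin 3) ≠ 1 by decide),
      pderiv_X_of_ne (show (0 : Fin 3) ≠ 2 by decide), pderiv_X_of_ne (show (1 : Fin 3) ≠ 0 by decide), pderiv_X_of_ne (show (1 : Fin 3) ≠ 2 by decide),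
      pderiv_X_of_ne (show (2 : Fin 3) ≠ 0 by decide), pderiv_X_of_ne (show (2 : Fin 3) ≠ 1 by decide), zero_add, smul_eq_mul, mul_one, nsmul_eq_mul]
    push_cast; ring

/-- The partials of `w₁`. [elementary] -/
theorem pderiv_w1 :
    pderiv 0 (1 + X 0 ^ 2 + X 0 ^ 3 + X 1 ^ 3 + X 2 ^ 3 : MvPolynomial (Fin 3) k) = 2 * X 0 + 3 * X 0 ^ 2 ∧
    pderiv 1 (1 + X 0 ^ 2 + X 0 ^ 3 + X 1 ^ 3 + X 2 ^ 3 : MvPolynomial (Fin 3) k) = 3 * X 1 ^ 2 ∧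
    pderiv 2 (1 + X 0 ^ 2 + X 0 ^ 3 + X 1 ^ 3 + X 2 ^ 3 : MvPolynomial (Fin 3) k) = 3 * X 2 ^ 2 := by
  refine ⟨?_, ?_, ?_⟩ <;>
  · simp only [map_add, Derivation.map_one_eq_zero, Derivation.leibniz_pow, pderiv_X_self, pderiv_X_of_ne (show (0 : Fin 3) ≠ 1 by decide),
      pderiv_X_of_ne (show (0 : Fin 3) ≠ 2 by decide), pderiv_X_of_ne (show (1 : Fin 3) ≠ 0 by decide), pderiv_X_of_ne (show (1 : Fin 3) ≠ 2 by decide),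
      pderiv_X_of_ne (show (2 : Fin 3) ≠ 0 by decide), pderiv_X_of_ne (show (2 : Fin 3) ≠ 1 by decide), zero_add, smul_eq_mul, mul_one, nsmul_eq_mul]
    push_cast; ring

/-- The partials of `w₂`. [elementary] -/
theorem pderiv_w2 :
    pderiv 0 (1 + X 0 ^ 3 + X 1 ^ 3 + X 2 ^ 3 + X 0 ^ 2 * X 1 : MvPolynomial (Fin 3) k) = 3 * X 0 ^ 2 + 2 * X 0 * X 1 ∧
    pderiv 1 (1 + X 0 ^ 3 + X 1 ^ 3 + X 2 ^ 3 + X 0 ^ 2 * X 1 : MvPolynomial (Fin 3) k) = 3 * X 1 ^ 2 + X 0 ^ 2 ∧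
    pderiv 2 (1 + X 0 ^ 3 + X 1 ^ 3 + X 2 ^ 3 + X 0 ^ 2 * X 1 : MvPolynomial (Fin 3) k) = 3 * X 2 ^ 2 := by
  refine ⟨?_, ?_, ?_⟩ <;>
  · simp only [map_add, Derivation.map_one_eq_zero, Derivation.leibniz_pow, Derivation.leibniz, pderiv_X_self,
      pderiv_X_of_ne (show (0 : Fin 3) ≠ 1 by decide), pderiv_X_of_ne (show (0 : Fin 3) ≠ 2 by decide), pderiv_X_of_ne (show (1 : Fin 3) ≠ 0 by decide),
      pderiv_X_of_ne (show (1 : Fin 3) ≠ 2 by decide), pderiv_X_of_ne (show (2 : Fin 3) ≠ 0 by decide), pderiv_X_of_ne (show (2 : Fin 3) ≠ 1 by decide),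
      zero_add, smul_eq_mul, mul_one, nsmul_eq_mul]
    push_cast; ring

/-- ★ **Smoothness of `V(w₀)`, GENUINELY POINTWISE** (`3, 31 ≠ 0`): `1 = A·w₀ + Σ B_j ∂_j w₀` with `A = (27 − 18Z₀)/31`, `B₀ = (6Z₀² − 9Z₀ + 4)/31`, `B_{1,2} = −(27 − 18Z₀)Z_{1,2}/93`
(from `31 = (27 − 18Z₀)(Z₀³ + Z₀ + 1) + (6Z₀² − 9Z₀ + 4)(3Z₀² + 1)`). [OURS · certificate] -/
theorem smooth_w0 (h3 : (3 : k) ≠ 0) (h31 : (31 : k) ≠ 0) :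
    ∀ 𝔮 : Ideal (MvPolynomial (Fin 3) k), 𝔮.IsPrime → (1 + X 0 + X 0 ^ 3 + X 1 ^ 3 + X 2 ^ 3 : MvPolynomial (Fin 3) k) ∈ 𝔮 →
      ∃ D : Derivation k (MvPolynomial (Fin 3) k) (MvPolynomial (Fin 3) k), D (1 + X 0 + X 0 ^ 3 + X 1 ^ 3 + X 2 ^ 3 : MvPolynomial (Fin 3) k) ∉ 𝔮 := by
  obtain ⟨d0, d1, d2⟩ := pderiv_w0 k
  refine X2CubicFormSmoothCert.smooth_of_jacobian_certificate k _ (C (31 : k)⁻¹ * (27 - 18 * X 0)) (C (31 : k)⁻¹ * (6 * X 0 ^ 2 - 9 * X 0 + 4))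
    (-(C (31 : k)⁻¹ * C (3 : k)⁻¹ * (27 - 18 * X 0) * X 1)) (-(C (31 : k)⁻¹ * C (3 : k)⁻¹ * (27 - 18 * X 0) * X 2)) ?_
  rw [d0, d1, d2]
  have h3C : (C (3 : k)⁻¹ : MvPolynomial (Fin 3) k) * 3 = 1 := by rw [← map_ofNat C 3, ← map_mul, inv_mul_cancel₀ h3, map_one]
  have h31C : (C (31 : k)⁻¹ : MvPolynomial (Fin 3) k) * 31 = 1 := by rw [← map_ofNat C 31, ← map_mul, inv_mul_cancel₀ h31, map_one]
  linear_combination h31C - (C (31 : k)⁻¹ * (27 - 18 * X 0) * (X 1 ^ 3 + X 2 ^ 3)) * h3C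

/-- ★ **Smoothness of `V(w₁)`, GENUINELY POINTWISE** (`3, 31 ≠ 0`): from `93 = (18Z₀ + 93)(Z₀³ + Z₀² + 1) − (6Z₀² + 33Z₀ + 9)(3Z₀² + 2Z₀)`. [OURS · certificate] -/
theorem smooth_w1 (h3 : (3 : k) ≠ 0) (h31 : (31 : k) ≠ 0) :
    ∀ 𝔮 : Ideal (MvPolynomial (Fin 3) k), 𝔮.IsPrime → (1 + X 0 ^ 2 + X 0 ^ 3 + X 1 ^ 3 + X 2 ^ 3 : MvPolynomial (Fin 3) k) ∈ 𝔮 →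
      ∃ D : Derivation k (MvPolynomial (Fin 3) k) (MvPolynomial (Fin 3) k), D (1 + X 0 ^ 2 + X 0 ^ 3 + X 1 ^ 3 + X 2 ^ 3 : MvPolynomial (Fin 3) k) ∉ 𝔮 := by
  obtain ⟨d0, d1, d2⟩ := pderiv_w1 k
  have h93 : (93 : k) ≠ 0 := by
    rw [show (93 : k) = 3 * 31 by norm_num]; exact mul_ne_zero h3 h31
  refine X2CubicFormSmoothCert.smooth_of_jacobian_certificate k _ (C (93 : k)⁻¹ * (18 * X 0 + 93)) (-(C (93 : k)⁻¹ * (6 * X 0 ^ 2 + 33 * X 0 + 9)))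
    (-(C (93 : k)⁻¹ * C (3 : k)⁻¹ * (18 * X 0 + 93) * X 1)) (-(C (93 : k)⁻¹ * C (3 : k)⁻¹ * (18 * X 0 + 93) * X 2)) ?_
  rw [d0, d1, d2]
  have h3C : (C (3 : k)⁻¹ : MvPolynomial (Fin 3) k) * 3 = 1 := by rw [← map_ofNat C 3, ← map_mul, inv_mul_cancel₀ h3, map_one]
  have h93C : (C (93 : k)⁻¹ : MvPolynomial (Fin 3) k) * 93 = 1 := by rw [← map_ofNat C 93, ← map_mul, inv_mul_cancel₀ h93, map_one]
  linear_combination h93C - (C (93 : k)⁻¹ * (18 * X 0 + 93) * (X 1 ^ 3 + X 2 ^ 3)) * h3C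

/-- **Smoothness of `V(w₂)`** (`3 ≠ 0`; Euler: `w₂ − Σ (Z_i/3)∂_i w₂ = 1`). [OURS · certificate] -/
theorem smooth_w2 (h3 : (3 : k) ≠ 0) :
    ∀ 𝔮 : Ideal (MvPolynomial (Fin 3) k), 𝔮.IsPrime → (1 + X 0 ^ 3 + X 1 ^ 3 + X 2 ^ 3 + X 0 ^ 2 * X 1 : MvPolynomial (Fin 3) k) ∈ 𝔮 →
      ∃ D : Derivation k (MvPolynomial (Fin 3) k) (MvPolynomial (Fin 3) k), D (1 + X 0 ^ 3 + X 1 ^ 3 + X 2 ^ 3 + X 0 ^ 2 * X 1 : MvPolynomial (Fin 3) k) ∉ 𝔮 := by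
  obtain ⟨d0, d1, d2⟩ := pderiv_w2 k
  refine X2CubicFormSmoothCert.smooth_of_jacobian_certificate k _ 1 (-(C (3 : k)⁻¹ * X 0)) (-(C (3 : k)⁻¹ * X 1)) (-(C (3 : k)⁻¹ * X 2)) ?_
  rw [d0, d1, d2]
  have h3C : (C (3 : k)⁻¹ : MvPolynomial (Fin 3) k) * 3 = 1 := by rw [← map_ofNat C 3, ← map_mul, inv_mul_cancel₀ h3, map_one]
  linear_combination (-(X 0 ^ 3 + X 1 ^ 3 + X 2 ^ 3 + X 0 ^ 2 * X 1)) * h3C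

/-! ## §4 The row -/

/-- ★★★ **THE (C31) ROW — the first NON-DIAGONAL member of the T-side class**: for every field `k` of characteristic `p ∉ {2, 3, 31}` and `f = X₄² + (Y₀³ + Y₁³ + Y₂³ + Y₃³ + Y₀²Y₁)(X₀..X₃)`:
SCOPE (v closed ∧ singular ∧ dim 4) ∧ LEGAL-AND-FULL point floor (for every blowing up along 𝔪̃·𝒪_{Y,v}) ∧ `TStepGerm.TStepInstanceAt p v (𝔪̃·𝒪_{Y,v})` — by ONE application of
`X2CubicFormTStepRow.tStep_row_of_doublePoint_cubicForm`. [OURS · application; evidence for nothing beyond itself] -/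
theorem tStep_row_C31 (p : ℕ) [Fact p.Prime] [CharP k p] (hp2 : p ≠ 2) (hp3 : p ≠ 3) (hp31 : p ≠ 31) (f : MvPolynomial (Fin 5) k)
    (hf : f = X 4 ^ 2 + rename (Fin.castSucc : Fin 4 → Fin 5) (X 0 ^ 3 + X 1 ^ 3 + X 2 ^ 3 + X 3 ^ 3 + X 0 ^ 2 * X 1 : MvPolynomial (Fin 4) k))
    (v : Spec (.of (MvPolynomial (Fin 5) k ⧸ Ideal.span {f})))
    (hv : v.asIdeal = Ideal.span (Set.range fun j : Fin 5 => Ideal.Quotient.mk (Ideal.span {f}) (X j))) :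
    (IsClosed ({v} : Set (Spec (.of (MvPolynomial (Fin 5) k ⧸ Ideal.span {f})))) ∧
      v ∉ Scheme.regularLocus (Spec (.of (MvPolynomial (Fin 5) k ⧸ Ideal.span {f}))) ∧
      ringKrullDim ((Spec (.of (MvPolynomial (Fin 5) k ⧸ Ideal.span {f}))).presheaf.stalk v) = (4 : ℕ)) ∧
    (∀ (S' : Scheme.{0}) (g : S' ⟶ Spec ((Spec (.of (MvPolynomial (Fin 5) k ⧸ Ideal.span {f}))).presheaf.stalk v)),
      IsBlowup g ((affineBlowup.idealSheaf (Ideal.span (Set.range (fun j : Fin 5 => Ideal.Quotient.mk (Ideal.span {f}) (X j))))).comap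
        ((Spec (.of (MvPolynomial (Fin 5) k ⧸ Ideal.span {f}))).fromSpecStalk v)) →
      ((affineBlowup.idealSheaf (Ideal.span (Set.range (fun j : Fin 5 => Ideal.Quotient.mk (Ideal.span {f}) (X j))))).comap
          ((Spec (.of (MvPolynomial (Fin 5) k ⧸ Ideal.span {f}))).fromSpecStalk v)) ≠ ⊥ ∧
      (((((affineBlowup.idealSheaf (Ideal.span (Set.range (fun j : Fin 5 => Ideal.Quotient.mk (Ideal.span {f}) (X j))))).comap
          ((Spec (.of (MvPolynomial (Fin 5) k ⧸ Ideal.span {f}))).fromSpecStalk v))).support :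
            Set (Spec ((Spec (.of (MvPolynomial (Fin 5) k ⧸ Ideal.span {f}))).presheaf.stalk v))) ⊆
          (Scheme.regularLocus (Spec ((Spec (.of (MvPolynomial (Fin 5) k ⧸ Ideal.span {f}))).presheaf.stalk v)))ᶜ) ∧
      (∀ s : S', g.base s ≠ closedPoint ((Spec (.of (MvPolynomial (Fin 5) k ⧸ Ideal.span {f}))).presheaf.stalk v) → s ∈ Scheme.regularLocus S') ∧
      (∀ s : S', FullCl p (S'.presheaf.stalk s))) ∧
    TStepGerm.TStepInstanceAt p v ((affineBlowup.idealSheaf (Ideal.span (Set.range fun j : Fin 5 => Ideal.Quotient.mk (Ideal.span {f}) (X j)))).comap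
      ((Spec (.of (MvPolynomial (Fin 5) k ⧸ Ideal.span {f}))).fromSpecStalk v)) := by
  obtain ⟨h2, h3⟩ := X2Cubic4Specimen.two_three_ne_zero k p hp2 hp3
  have h31 : (31 : k) ≠ 0 := by exact_mod_cast X2Cubic4Specimen.natCast_ne_zero_of_prime_ne k p 31 (by norm_num) hp31
  have hf' := f_eq k f hf
  refine X2CubicFormTStepRow.tStep_row_of_doublePoint_cubicForm k p _ (isHomogeneous_F k) f hf (X2C31Specimen.prime_f k h3 f hf')
    (fun P _ hP => X2C31Specimen.regular_off_vertex k h2 h3 h31 f hf' P hP) (fun a => ?_) (fun a => ?_) v hv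
  · rw [dehomog]
    fin_cases a
    · exact prime_w0 k h3
    · exact prime_w1 k h3
    · exact prime_w2 k
    · exact prime_w2 k
  · rw [dehomog]
    fin_cases a
    · exact smooth_w0 k h3 h31
    · exact smooth_w1 k h3 h31
    · exact smooth_w2 k h3
    · exact smooth_w2 k h3

end Summit.ResolutionOfSingularities.ResolutionOfSingularities.Theorems.FInjectiveMacaulayfication.X2C31ClassRow

end
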